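/-
Copyright (c) 2026. All rights reserved.
Released under Apache 2.0 license as described in the file LICENSE.
-/
import Summits.HubbardSuperconductivity.HubbardLadder.Bounds.SectorRatioFromDressing
import HarnessLib

/-!
# The sector ratio identity (bounds.tex §13, Lemma 13.7) — model input W1a

HONEST FRAMING: ladder R1–R4 with certified numbers; no claim on H/H₀. These are bounds for
MODEL CLASSES (the typed repulsive/attractive Hubbard torus with a flux twist), no materials
claim. This part PROVES the hypothesis `hid` (W1a) of
`SectorRatioFromDressing.sectorRatioBound_of_identity_of_dressing`: for the untwisted `t–t'`
Hubbard torus `H = H^{tt'}_L(0)` with `n = |Orb Λ_L|` orbitals, `G = e^{-βH}`, `P_k` the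
particle-number projections and `X_i = e^{-βH} c_i e^{βH} - c_i`,

`(n - k) Z_k - (k+1) Z_{k+1} = Σ_i Tr(c†_i X_i (P_{k+1} G P_{k+1}))`
(`ttSectorZ_ratio_identity`).

Ingredients (pure CAR bookkeeping, all in the occupation basis): `P_k c_i = c_i P_{k+1}`
(`numberSectorProj_mul_annihilation`), `Σ_i c_i c†_i = n - N̂`
(`sum_annihilation_mul_creation`),
`N̂ P_k = k P_k`, number conservation `[N̂, H] = 0 ⟹ [P_k, e^{∓βH}] = 0`
(`numberSectorProj_mul_gibbsWeight_comm`), `e^{βH} e^{-βH} = 1`, and cyclicity of the trace.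
After this part the N-sector device is conditional exactly on the dressing bound W2
(`‖X_i‖ ≤ r`, volume-independent `r(β, t', U)`) and the node instantiation D5.

No numerics, no `native_decide`; standard axioms only. References: folklore (CAR algebra);
programme notes bounds.tex §13.
-/

noncomputable section

namespace Summit.HubbardSuperconductivity.HubbardLadder.Bounds

open Matrix Finset Complex
open Literature.MathematicalPhysics.QuantumLattice
open Literature.MathematicalPhysics.QuantumLattice.HubbardWave0
open scoped Matrix.Norms.L2Operator ComplexOrder

/-! ### CAR bookkeeping with the particle-number projections -/

section Fock

variable {ι : Type*} [LinearOrder ι] [Fintype ι]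

/-- `P_k c_i = c_i P_{k+1}`: the annihilation operator lowers the particle number by one.
[folklore] -/
theorem numberSectorProj_mul_annihilation (i : ι) (k : ℕ) :
    numberSectorProj ι k * annihilation i = annihilation i * numberSectorProj ι (k + 1) := by
  ext s t
  rw [numberSectorProj, numberSectorProj, diagonal_mul, mul_diagonal]
  by_cases h : i ∉ s ∧ t = insert i s
  · have hc : t.card = s.card + 1 := by rw [h.2, Finset.card_insert_of_notMem h.1]
    simp only [annihilation, if_pos h, hc]
    by_cases hk : s.card = k
    · simp [hk]
    · simp [hk]
  · simp only [annihilation, if_neg h, mul_zero, zero_mul]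

/-- `c†_i P_{k+1}ᶜ…`: dually, `P_{k+1} c†_i = c†_i P_k` (the creation operator raises the
particle number by one). [folklore] -/
theorem numberSectorProj_mul_creation (i : ι) (k : ℕ) :
    numberSectorProj ι (k + 1) * creation i = creation i * numberSectorProj ι k := by
  have h := congrArg conjTranspose (numberSectorProj_mul_annihilation i k)
  simp only [conjTranspose_mul, conjTranspose_numberSectorProj, annihilation_conjTranspose] at h
  exact h.symm

/-- `Σ_i c_i c†_i = n · 1 - N̂` (`n = |ι|`), from the CAR `c_i c†_i + c†_i c_i = 1`. [folklore] -/
theorem sum_annihilation_mul_creation :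
    ∑ i : ι, annihilation i * creation i =
      (Fintype.card ι : ℂ) • (1 : Matrix (Finset ι) (Finset ι) ℂ) - totalNumberOp := by
  have h : ∀ i : ι, annihilation i * creation i = 1 - numberAt i := fun i => by
    have hc := annihilation_mul_creation_add_creation_mul_annihilation_holds (ι := ι) i i
    rw [if_pos rfl] at hc
    rw [numberAt]
    exact eq_sub_of_add_eq hc
  simp only [h, Finset.sum_sub_distrib, Finset.sum_const, Finset.card_univ, totalNumberOp,
    Nat.cast_smul_eq_nsmul]

/-- `N̂ P_k = k P_k`. [folklore] -/
theorem totalNumberOp_mul_numberSectorProj (k : ℕ) :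
    totalNumberOp * numberSectorProj ι k = (k : ℂ) • numberSectorProj ι k := by
  ext s t
  rw [totalNumberOp_eq_diagonal, numberSectorProj, mul_diagonal, diagonal_apply,
    Matrix.smul_apply, diagonal_apply]
  by_cases hst : s = t
  · subst hst
    by_cases hk : s.card = k
    · simp [hk]
    · simp [hk]
  · simp [hst]

/-- `P_k N̂ = k P_k`. [folklore] -/
theorem numberSectorProj_mul_totalNumberOp (k : ℕ) :
    numberSectorProj ι k * totalNumberOp = (k : ℂ) • numberSectorProj ι k := by
  ext s t
  rw [totalNumberOp_eq_diagonal, numberSectorProj, diagonal_mul, diagonal_apply,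
    Matrix.smul_apply, diagonal_apply]
  by_cases hst : s = t
  · subst hst
    by_cases hk : s.card = k
    · simp [hk]
    · simp [hk]
  · simp [hst]

/-- A number-conserving matrix (`G_{st} ≠ 0 ⟹ #s = #t`) commutes with every `P_k`. [folklore] -/
theorem numberSectorProj_mul_comm_of_card {G : Matrix (Finset ι) (Finset ι) ℂ}
    (hG : ∀ s t, G s t ≠ 0 → s.card = t.card) (k : ℕ) :
    numberSectorProj ι k * G = G * numberSectorProj ι k := by
  ext s t
  rw [numberSectorProj, diagonal_mul, mul_diagonal]
  by_cases h0 : G s t = 0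
  · simp [h0]
  · have hc := hG s t h0
    by_cases hk : s.card = k
    · have hk' : t.card = k := hc ▸ hk
      simp [hk, hk']
    · have hk' : ¬ t.card = k := fun e => hk (hc.trans e)
      simp [hk, hk']

/-- A number-conserving matrix commutes with `N̂`. [folklore] -/
theorem commute_totalNumberOp_of_card {H : Matrix (Finset ι) (Finset ι) ℂ}
    (hH : ∀ s t, H s t ≠ 0 → s.card = t.card) : Commute totalNumberOp H := by
  change totalNumberOp * H = H * totalNumberOp
  ext s t
  rw [totalNumberOp_eq_diagonal, diagonal_mul, mul_diagonal]
  by_cases h0 : H s t = 0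
  · simp [h0]
  · rw [hH s t h0, mul_comm]

/-- A matrix commuting with `N̂` is number-conserving. [folklore] -/
theorem card_eq_of_commute_totalNumberOp {G : Matrix (Finset ι) (Finset ι) ℂ}
    (hG : Commute totalNumberOp G) (s t : Finset ι) (h : G s t ≠ 0) : s.card = t.card := by
  have e := congrFun (congrFun hG.eq s) t
  rw [totalNumberOp_eq_diagonal, diagonal_mul, mul_diagonal] at e
  have e' : ((s.card : ℂ) - t.card) * G s t = 0 := by rw [sub_mul]; exact sub_eq_zero.2 (by
    rw [e, mul_comm])
  rcases mul_eq_zero.1 e' with h1 | h1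
  · exact_mod_cast sub_eq_zero.1 h1
  · exact absurd h1 h

/-- The Gibbs weight of a number-conserving Hamiltonian is number-conserving
(`[N̂, H] = 0 ⟹ [N̂, e^{-βH}] = 0`, `Commute.exp_right`). [folklore] -/
theorem gibbsWeight_card_eq {H : Matrix (Finset ι) (Finset ι) ℂ}
    (hH : ∀ s t, H s t ≠ 0 → s.card = t.card) (β : ℝ) (s t : Finset ι)
    (h : gibbsWeight β H s t ≠ 0) : s.card = t.card :=
  card_eq_of_commute_totalNumberOp
    (((commute_totalNumberOp_of_card hH).smul_right (-(β : ℂ))).exp_right) s t h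

/-- `P_k e^{-βH} = e^{-βH} P_k` for a number-conserving `H`. [folklore] -/
theorem numberSectorProj_mul_gibbsWeight_comm {H : Matrix (Finset ι) (Finset ι) ℂ}
    (hH : ∀ s t, H s t ≠ 0 → s.card = t.card) (β : ℝ) (k : ℕ) :
    numberSectorProj ι k * gibbsWeight β H = gibbsWeight β H * numberSectorProj ι k :=
  numberSectorProj_mul_comm_of_card (gibbsWeight_card_eq hH β) k

/-- **THE ABSTRACT SECTOR RATIO IDENTITY.** For number-conserving matrices `G, G'` on the Fock
space over `ι` (`n = |ι|`) with `G' G = 1` and `P_k` the particle-number projections: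
`(n - k) Tr(G P_k) - (k+1) Tr(P_{k+1} G P_{k+1})`
`= Σ_i Tr(c†_i (G c_i G' - c_i) (P_{k+1} G P_{k+1}))`.
Proof: `G' P G P = P` (`P = P_{k+1}` commutes with `G, G'`), `c_i P_{k+1} = P_k c_i`, cyclicity,
`Σ_i c_i c†_i = n - N̂`, `Σ_i c†_i c_i = N̂`, `N̂ P_k = k P_k`. [folklore; this file] -/
theorem sector_ratio_identity_of_card {G G' : Matrix (Finset ι) (Finset ι) ℂ}
    (hG : ∀ s t, G s t ≠ 0 → s.card = t.card) (hG' : ∀ s t, G' s t ≠ 0 → s.card = t.card)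
    (hG'G : G' * G = 1) (k : ℕ) :
    ((Fintype.card ι : ℂ) - k) * (G * numberSectorProj ι k).trace -
        ((k : ℂ) + 1) * (numberSectorProj ι (k + 1) * G * numberSectorProj ι (k + 1)).trace =
      ∑ i : ι, (creation i * (G * annihilation i * G' - annihilation i) *
        (numberSectorProj ι (k + 1) * G * numberSectorProj ι (k + 1))).trace := by
  set P := numberSectorProj ι (k + 1) with hP_def
  set Q := numberSectorProj ι k with hQ_def
  have hPG : P * G = G * P := numberSectorProj_mul_comm_of_card hG (k + 1)
  have hPP : P * P = P := numberSectorProj_mul_self (k + 1)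
  -- `G' P G P = P`
  have hsand : G' * P * G * P = P := by
    have hPG' : P * G' = G' * P := numberSectorProj_mul_comm_of_card hG' (k + 1)
    calc G' * P * G * P = G' * (P * G) * P := by simp only [Matrix.mul_assoc]
      _ = G' * (G * P) * P := by rw [hPG]
      _ = (G' * G) * (P * P) := by simp only [Matrix.mul_assoc]
      _ = P := by rw [hG'G, hPP, Matrix.one_mul]
  -- termwise rewriting
  have hterm : ∀ i : ι,
      (creation i * (G * annihilation i * G' - annihilation i) * (P * G * P)).trace =
        (annihilation i * creation i * (G * Q)).trace - (numberAt i * (P * G * P)).trace := by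
    intro i
    have e1 : creation i * (G * annihilation i * G') * (P * G * P) =
        creation i * G * Q * annihilation i := by
      calc creation i * (G * annihilation i * G') * (P * G * P)
          = creation i * G * annihilation i * (G' * P * G * P) := by simp only [Matrix.mul_assoc]
        _ = creation i * G * (annihilation i * P) := by rw [hsand]; simp only [Matrix.mul_assoc]
        _ = creation i * G * (Q * annihilation i) := by
            rw [hP_def, hQ_def, numberSectorProj_mul_annihilation]
        _ = creation i * G * Q * annihilation i := by simp only [Matrix.mul_assoc]
    rw [mul_sub, sub_mul, trace_sub, e1, trace_mul_comm _ (annihilation i), numberAt]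
    simp only [Matrix.mul_assoc]
  rw [Finset.sum_congr rfl fun i _ => hterm i, Finset.sum_sub_distrib, ← trace_sum, ← trace_sum,
    ← Finset.sum_mul, ← Finset.sum_mul, sum_annihilation_mul_creation]
  -- `Σ_i n_i = N̂` by definition
  have hN : ∑ i : ι, numberAt i = totalNumberOp := rfl
  rw [hN]
  -- `Tr(N̂ G Q) = k Tr(G Q)` and `Tr(N̂ P G P) = (k+1) Tr(P G P)`
  have h1 : (totalNumberOp * (G * Q)).trace = (k : ℂ) * (G * Q).trace := by
    rw [trace_mul_comm, Matrix.mul_assoc, hQ_def, numberSectorProj_mul_totalNumberOp,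
      mul_smul_comm, trace_smul, smul_eq_mul]
  have h2 : (totalNumberOp * (P * G * P)).trace = ((k : ℂ) + 1) * (P * G * P).trace := by
    rw [← Matrix.mul_assoc, ← Matrix.mul_assoc, hP_def, totalNumberOp_mul_numberSectorProj,
      smul_mul_assoc, smul_mul_assoc, trace_smul, smul_eq_mul]
    push_cast
    ring
  have hA : ((((Fintype.card ι : ℂ)) • (1 : Matrix (Finset ι) (Finset ι) ℂ) - totalNumberOp) *
      (G * Q)).trace = (Fintype.card ι : ℂ) * (G * Q).trace - (k : ℂ) * (G * Q).trace := by
    rw [sub_mul, smul_mul_assoc, Matrix.one_mul, trace_sub, trace_smul, smul_eq_mul, h1]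
  rw [hA, h2]
  ring

/-- The abstract identity for a Gibbs weight `G = e^{-βH}`, `G' = e^{βH}` of a number-conserving
`H`, with the sector traces written as diagonal sums. [folklore; this file] -/
theorem sector_ratio_identity_gibbs {H : Matrix (Finset ι) (Finset ι) ℂ}
    (hH : ∀ s t, H s t ≠ 0 → s.card = t.card) (β : ℝ) (k : ℕ) :
    ((Fintype.card ι : ℂ) - k) *
          (∑ s ∈ Finset.univ.filter (fun s : Finset ι => s.card = k), gibbsWeight β H s s) -
        ((k : ℂ) + 1) *
          (∑ s ∈ Finset.univ.filter (fun s : Finset ι => s.card = k + 1), gibbsWeight β H s s) =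
      ∑ i : ι, (creation i * (gibbsWeight β H * annihilation i * gibbsWeight (-β) H -
        annihilation i) * (numberSectorProj ι (k + 1) * gibbsWeight β H *
          numberSectorProj ι (k + 1))).trace := by
  have hG'G : gibbsWeight (-β) H * gibbsWeight β H = 1 := by
    rw [gibbsWeight_mul_gibbsWeight, neg_add_cancel, Matrix.gibbsWeight_zero]
  have h := sector_ratio_identity_of_card (gibbsWeight_card_eq hH β) (gibbsWeight_card_eq hH (-β))
    hG'G k
  rw [trace_mul_numberSectorProj, trace_numberSectorProj_mul_mul] at h
  exact h

end Fock

/-! ### The identity for the `t–t'` Hubbard torus -/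

variable {L : ℕ} [NeZero L]

/-- The `t–t'` Hubbard torus conserves the particle number. [this file] -/
theorem hubbardTorusTT'Flux_card_eq (t' U θ : ℝ) (s t : Finset (Orb (FermionTorus 2 L)))
    (h : hubbardTorusTT'Flux L t' U θ s t ≠ 0) : s.card = t.card :=
  card_eq_of_preservesSectors (preservesSectors_hubbardTorusTT'Flux L t' U θ) s t h

/-- **W1a — THE SECTOR RATIO IDENTITY** (hypothesis `hid` of
`sectorRatioBound_of_identity_of_dressing`): with `n = |Orb Λ_L|`, `H = H^{tt'}_L(0)`,
`X_i = e^{-βH} c_i e^{βH} - c_i` and `P = P_{k+1}`,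
`(n - k) Z_k - (k+1) Z_{k+1} = Σ_i Tr(c†_i X_i (P e^{-βH} P))`. [folklore; this file] -/
theorem ttSectorZ_ratio_identity (β t' U : ℝ) (k : ℕ) :
    ((Fintype.card (Orb (FermionTorus 2 L)) : ℂ) - k) * ttSectorZ L β t' U 0 k -
        ((k : ℂ) + 1) * ttSectorZ L β t' U 0 (k + 1) =
      ∑ i : Orb (FermionTorus 2 L),
        (creation i *
          (gibbsWeight β (hubbardTorusTT'Flux L t' U 0) * annihilation i *
              gibbsWeight (-β) (hubbardTorusTT'Flux L t' U 0) - annihilation i) *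
          (numberSectorProj (Orb (FermionTorus 2 L)) (k + 1) *
            gibbsWeight β (hubbardTorusTT'Flux L t' U 0) *
            numberSectorProj (Orb (FermionTorus 2 L)) (k + 1))).trace := by
  rw [ttSectorZ_eq_sum, ttSectorZ_eq_sum]
  -- `convert` bridges the two (propositionally equal) `DecidableEq` instance paths on `Orb Λ_L`
  convert sector_ratio_identity_gibbs (hubbardTorusTT'Flux_card_eq (L := L) t' U 0) β k

/-- **THE SECTOR RATIO BOUND FROM THE DRESSING BOUND ALONE** (W1a discharged): if
`‖e^{-βH} c_i e^{βH} - c_i‖ ≤ r` for every orbital `i` (`H = H^{tt'}_L(0)`), then for every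
`k + 1 ≤ n = |Orb Λ_L|`,
`|(n - k) Z_k - (k+1) Z_{k+1}| ≤ n · r · Z_{k+1}` — verbatim the hypothesis `hratio` of
`SectorRatioEnvelope.walk_input_of_ratio_bound` with `w = ttSectorWeight`. The device for
bounds.tex Theorem 13_N is now conditional only on the dressing radius `r(β, t', U)` (W2) and the
node instantiation (D5). [this file] -/
theorem sectorRatioBound_of_dressing {β t' U r : ℝ}
    (hD : ∀ i : Orb (FermionTorus 2 L),
      ‖gibbsWeight β (hubbardTorusTT'Flux L t' U 0) * annihilation i *
          gibbsWeight (-β) (hubbardTorusTT'Flux L t' U 0) - annihilation i‖ ≤ r) :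
    ∀ k : ℕ, k + 1 ≤ Fintype.card (Orb (FermionTorus 2 L)) →
      |((Fintype.card (Orb (FermionTorus 2 L)) : ℝ) - k) * ttSectorWeight L β t' U k -
          ((k : ℝ) + 1) * ttSectorWeight L β t' U (k + 1)| ≤
        Fintype.card (Orb (FermionTorus 2 L)) * r * ttSectorWeight L β t' U (k + 1) :=
  sectorRatioBound_of_identity_of_dressing (ttSectorZ_ratio_identity β t' U) hD

end Summit.HubbardSuperconductivity.HubbardLadder.Bounds
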